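import Literature.Analysis.FunctionSpaces.TorusTrigPoly
import Mathlib.MeasureTheory.Integral.Pi

/-!
# K1loc, line `Spectral` / thin start — helper: THE INPUT-FREE TRACE BOUND FOR THE CORNER-TRACE GRADE («TraceInput»)

Helper file of the prover lane on the crux `K1LocalisedCascade` (stmt-AnomalousDissipation-19491), route `SawtoothPulseCascade`
(glue seat; arbiter A23-11 (iv): the CT dischargers).  The corner-trace bound `…CornerTraceSum.cornerTrace_sum_sq_le` controls the
window energy received from ONE fibre `n` of a half-step through the TRACE of the filtered source fibre,
`T_n(y) = Σ_{l∈S} χ_l 𝓕b(n,l) e^{2πily}`, at the `2N` corner lines `y = (4r∓1)/(4N)`.  Summed over the fibres of a block the input is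
`Σ_n |T_n(y)|²`, and this file supplies its INPUT-FREE bound: for every `b : 𝕋² → ℂ` with `‖b‖_∞ ≤ B`, every finite multiplier
`χ` on `S`, every finite fibre set `F` and every `y`,
  **`Σ_{n∈F} |Σ_{l∈S} χ_l 𝓕b(k(n,l)) e^{2πily}|² ≤ (‖K_{χ,y}‖_{L¹(𝕋)} · B)²**,  `K_{χ,y}(t) = Σ_{l∈S} χ_l e^{2πily} e_{−l}(t)`
(`sum_sq_trace_le_hfibre`: fibre coordinate `0`, sources along coordinate `1`, `k(n,l) = (n,l)` — the H half-step;
`sum_sq_trace_le_vfibre`: `k(n,l) = (l,n)` — the V half-step).  Mechanism (duality, no slicing): with `d_n = T_n(y)` the double sum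
`Σ_n conj(d_n) T_n(y)` is the pairing `∫_{𝕋²} Ψ̄·b` of `b` with the PRODUCT trigonometric polynomial `Ψ(x) = D(x_0)·K(x_1)`,
`D = Σ_n d_n e_n`; so `Σ_n|T_n|² ≤ B‖Ψ‖_{L¹(𝕋²)} = B‖D‖_{L¹(𝕋)}‖K‖_{L¹(𝕋)} ≤ B (Σ_n|d_n|²)^{1/2} ‖K‖_{L¹}` (product Haar measure,
`MeasureTheory.integral_fintype_prod_volume_eq_prod`; Cauchy–Schwarz and the finite Parseval identity
`Torus.integral_norm_sq_trigPoly`).  The `L¹` norms of the concrete multipliers (Fejér-difference trapezoids) are a separate file.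
No definitions; nothing about the crux. [cite: Grafakos2014, Prop. 3.1.2 (5), Prop. 3.2.7 (3), §3.1.3] [problem: turb]
-/

-- `Summit.<Summit>.<Problem>`: single-conjunct summit, the duplicate namespace segment is deliberate.
set_option linter.dupNamespace false

noncomputable section

namespace Summit.AnomalousDissipation.AnomalousDissipation.Theorems.SawtoothPulseCascade.K1Window

open MeasureTheory Complex UnitAddTorus
open scoped Real
open Literature.Analysis.FunctionSpaces Literature.Analysis.FunctionSpaces.Torus

/-! ## §1 Product integrals on `𝕋²` and the `L¹ ≤ ℓ²` bound for one-variable trigonometric sums -/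

/-- **Product rule on `𝕋² = (Fin 2 → 𝕋)`**: `∫ f(x_0) g(x_1) dx = (∫ f)(∫ g)` for the (product Haar probability) volume. [folklore] -/
theorem integral_mul_coord_eq (f g : UnitAddCircle → ℝ) :
    ∫ x : UnitAddTorus (Fin 2), f (x 0) * g (x 1) = (∫ t : UnitAddCircle, f t) * ∫ t : UnitAddCircle, g t := by
  have h := MeasureTheory.integral_fintype_prod_volume_eq_prod (ι := Fin 2) (𝕜 := ℝ) (E := fun _ => UnitAddCircle) ![f, g]
  simp only [Fin.prod_univ_two, Matrix.cons_val_zero, Matrix.cons_val_one] at h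
  exact h

/-- `∫_{𝕋²} f(x_0) dx = ∫_𝕋 f`. [folklore] -/
theorem integral_coord_zero_eq (f : UnitAddCircle → ℝ) :
    ∫ x : UnitAddTorus (Fin 2), f (x 0) = ∫ t : UnitAddCircle, f t := by
  have h := integral_mul_coord_eq f (fun _ => 1)
  simp only [mul_one] at h
  rw [h, integral_const, smul_eq_mul, probReal_univ]
  ring

/-- `∫_{𝕋²} f(x_1) dx = ∫_𝕋 f`. [folklore] -/
theorem integral_coord_one_eq (f : UnitAddCircle → ℝ) :
    ∫ x : UnitAddTorus (Fin 2), f (x 1) = ∫ t : UnitAddCircle, f t := by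
  have h := integral_mul_coord_eq (fun _ => 1) f
  simp only [one_mul] at h
  rw [h, integral_const, smul_eq_mul, probReal_univ]
  ring

/-- A one-variable character is a two-variable monomial: `e_{(m,0)}(x) = e_m(x_0)`. [folklore] -/
theorem mFourier_vecCons_zero (m : ℤ) (x : UnitAddTorus (Fin 2)) :
    mFourier ![m, 0] x = fourier m (x 0) := by
  show (∏ i : Fin 2, (fourier ((![m, 0] : Fin 2 → ℤ) i) (x i) : ℂ)) = _
  simp [Fin.prod_univ_two]

/-- The two-variable monomial factorises: `e_{−(n,l)}(x) = e_{−n}(x_0) e_{−l}(x_1)`. [folklore] -/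
theorem mFourier_neg_vecCons (n l : ℤ) (x : UnitAddTorus (Fin 2)) :
    mFourier (-![n, l]) x = fourier (-n) (x 0) * fourier (-l) (x 1) := by
  show (∏ i : Fin 2, (fourier ((-(![n, l] : Fin 2 → ℤ)) i) (x i) : ℂ)) = _
  simp [Fin.prod_univ_two]

/-- **`L¹ ≤ ℓ²` for a one-variable trigonometric sum** (Cauchy–Schwarz on the probability space `𝕋` and the finite Parseval
identity): `(∫_𝕋 |Σ_{n∈F} d_n e_{−n}|)² ≤ Σ_{n∈F} |d_n|²`. [cite: Grafakos2014, Prop. 3.2.7 (3)] -/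
theorem sq_integral_norm_trigSum_le (F : Finset ℤ) (dcoef : ℤ → ℂ) :
    (∫ t : UnitAddCircle, ‖∑ n ∈ F, dcoef n * fourier (-n) t‖) ^ 2 ≤ ∑ n ∈ F, ‖dcoef n‖ ^ 2 := by
  classical
  -- the lift `D̃(x) = D(x_0)` is the trigonometric polynomial with frequencies `(-n, 0)` and coefficients `d_n`
  set ι : ℤ → (Fin 2 → ℤ) := fun n => ![-n, 0] with hι
  have hιinj : Function.Injective ι := by
    intro a b h
    have := congr_fun h 0
    simpa [hι] using this
  set c : (Fin 2 → ℤ) → ℂ := fun k => dcoef (-(k 0)) with hc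
  have hD : ∀ x : UnitAddTorus (Fin 2), trigPoly (F.image ι) c x = ∑ n ∈ F, dcoef n * fourier (-n) (x 0) := by
    intro x
    rw [trigPoly_apply, Finset.sum_image fun a _ b _ h => hιinj h]
    refine Finset.sum_congr rfl fun n _ => ?_
    rw [hι, hc, smul_eq_mul, mFourier_vecCons_zero]
    simp [mul_comm]
  -- Parseval for the lift
  have hP : ∫ x : UnitAddTorus (Fin 2), ‖trigPoly (F.image ι) c x‖ ^ 2 = ∑ n ∈ F, ‖dcoef n‖ ^ 2 := by
    rw [integral_norm_sq_trigPoly, Finset.sum_image fun a _ b _ h => hιinj h]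
    refine Finset.sum_congr rfl fun n _ => ?_
    simp [hι, hc]
  -- the `L¹` norm of the lift is the one-variable `L¹` norm
  have hL1 : ∫ x : UnitAddTorus (Fin 2), ‖trigPoly (F.image ι) c x‖ = ∫ t : UnitAddCircle, ‖∑ n ∈ F, dcoef n * fourier (-n) t‖ := by
    simp_rw [hD]
    exact integral_coord_zero_eq (fun t => ‖∑ n ∈ F, dcoef n * fourier (-n) t‖)
  -- Cauchy–Schwarz on a probability space: `(∫|g|)² ≤ ∫|g|²` via `0 ≤ ∫ (|g| − m)²`
  have hcont : Continuous (trigPoly (F.image ι) c) := continuous_trigPoly _ _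
  set g : UnitAddTorus (Fin 2) → ℝ := fun x => ‖trigPoly (F.image ι) c x‖ with hg
  have hgc : Continuous g := hcont.norm
  have hgi : Integrable g volume := hgc.integrable_unitAddTorus
  have hg2i : Integrable (fun x => g x ^ 2) volume := (hgc.pow 2).integrable_unitAddTorus
  set m : ℝ := ∫ x, g x with hm
  have hvar : 0 ≤ ∫ x, (g x - m) ^ 2 := integral_nonneg fun x => sq_nonneg _
  have hexp : ∫ x, (g x - m) ^ 2 = (∫ x, g x ^ 2) - m ^ 2 := by
    have e : ∀ x, (g x - m) ^ 2 = (g x ^ 2 - (2 * m) * g x) + m ^ 2 := fun x => by ring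
    simp_rw [e]
    have hi1 : Integrable (fun x => g x ^ 2 - (2 * m) * g x) volume := hg2i.sub (hgi.const_mul _)
    have hi2 : Integrable (fun x => (2 * m) * g x) volume := hgi.const_mul _
    rw [integral_add hi1 (integrable_const _), integral_sub hg2i hi2, integral_const_mul, integral_const, smul_eq_mul,
      probReal_univ, one_mul, ← hm]
    ring
  rw [← hL1, ← hP]
  change m ^ 2 ≤ ∫ x, g x ^ 2
  linarith

section Core

variable {b : UnitAddTorus (Fin 2) → ℂ}

/-! ## §2 The pairing identity and the trace bound, H orientation (fibre coordinate `0`, sources along `1`) -/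

set_option maxHeartbeats 400000 in
/-- **INPUT-FREE TRACE BOUND, H half-step orientation.**  `b` integrable with `‖b x‖ ≤ B` everywhere, `χ` a multiplier on the finite
source set `S`, `F` a finite set of fibres, `y ∈ ℝ`, and `∫_𝕋 |Σ_{l∈S} χ_l e^{2πily} e_{−l}(t)| dt ≤ K₁`.  Then
`Σ_{n∈F} |Σ_{l∈S} χ_l 𝓕b(n,l) e^{2πily}|² ≤ (K₁B)²`. [cite: Grafakos2014, Prop. 3.1.2 (5), Prop. 3.2.7 (3)] -/
theorem sum_sq_trace_le_hfibre (hb : Integrable b volume) {B : ℝ} (hB : ∀ x, ‖b x‖ ≤ B) (χ : ℤ → ℂ) (S F : Finset ℤ)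
    (y : ℝ) {K₁ : ℝ} (hK : ∫ t : UnitAddCircle, ‖∑ l ∈ S, χ l * cexp (2 * π * I * l * y) * fourier (-l) t‖ ≤ K₁) :
    ∑ n ∈ F, ‖∑ l ∈ S, χ l * mFourierCoeff b ![n, l] * cexp (2 * π * I * l * y)‖ ^ 2 ≤ (K₁ * B) ^ 2 := by
  classical
  have hB0 : 0 ≤ B := le_trans (norm_nonneg _) (hB 0)
  set e : ℤ → ℂ := fun l => cexp (2 * π * I * l * y) with he
  set T : ℤ → ℂ := fun n => ∑ l ∈ S, χ l * mFourierCoeff b ![n, l] * e l with hT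
  set Λ2 : ℝ := ∑ n ∈ F, ‖T n‖ ^ 2 with hΛ2
  have hΛ2nn : 0 ≤ Λ2 := Finset.sum_nonneg fun n _ => sq_nonneg _
  -- the two one-variable factors
  set D : UnitAddCircle → ℂ := fun t => ∑ n ∈ F, (starRingEnd ℂ) (T n) * fourier (-n) t with hD
  set K : UnitAddCircle → ℂ := fun t => ∑ l ∈ S, χ l * e l * fourier (-l) t with hKdef
  have hDc : Continuous D := by
    refine continuous_finsetSum _ fun n _ => continuous_const.mul (fourier (-n)).continuous
  have hKc : Continuous K := by
    refine continuous_finsetSum _ fun l _ => continuous_const.mul (fourier (-l)).continuous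
  set Ψ : UnitAddTorus (Fin 2) → ℂ := fun x => D (x 0) * K (x 1) with hΨ
  have hΨc : Continuous Ψ := (hDc.comp (continuous_apply 0)).mul (hKc.comp (continuous_apply 1))
  -- (1) the pairing identity `Σ_n conj(T n) T n = ∫ Ψ b`
  have hterm : ∀ n l, (starRingEnd ℂ) (T n) * (χ l * mFourierCoeff b ![n, l] * e l) =
      ∫ x : UnitAddTorus (Fin 2), ((starRingEnd ℂ) (T n) * χ l * e l * mFourier (-![n, l]) x) * b x := by
    intro n l
    have h1 : mFourierCoeff b ![n, l] = ∫ x : UnitAddTorus (Fin 2), mFourier (-![n, l]) x * b x := by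
      rw [Torus.mFourierCoeff_eq_integral_volume]; rfl
    calc (starRingEnd ℂ) (T n) * (χ l * mFourierCoeff b ![n, l] * e l)
        = ((starRingEnd ℂ) (T n) * χ l * e l) * ∫ x : UnitAddTorus (Fin 2), mFourier (-![n, l]) x * b x := by
          rw [h1]; ring
      _ = ∫ x : UnitAddTorus (Fin 2), ((starRingEnd ℂ) (T n) * χ l * e l) * (mFourier (-![n, l]) x * b x) :=
          (integral_const_mul _ _).symm
      _ = ∫ x : UnitAddTorus (Fin 2), ((starRingEnd ℂ) (T n) * χ l * e l * mFourier (-![n, l]) x) * b x :=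
          integral_congr_ae (ae_of_all _ fun x => by ring)
  have hint : ∀ n l, Integrable (fun x : UnitAddTorus (Fin 2) =>
      ((starRingEnd ℂ) (T n) * χ l * e l * mFourier (-![n, l]) x) * b x) volume := by
    intro n l
    refine hb.bdd_mul (c := ‖(starRingEnd ℂ) (T n) * χ l * e l‖)
      ((continuous_const.mul (mFourier (-![n, l])).continuous).aestronglyMeasurable) (ae_of_all _ fun x => ?_)
    rw [norm_mul]
    have h1 : ‖mFourier (-![n, l]) x‖ ≤ 1 := by
      have := (mFourier (-![n, l])).norm_coe_le_norm x
      rwa [mFourier_norm] at this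
    exact mul_le_of_le_one_right (norm_nonneg _) h1
  have hpair : ((Λ2 : ℝ) : ℂ) = ∫ x, Ψ x * b x := by
    have h1 : ((Λ2 : ℝ) : ℂ) = ∑ n ∈ F, (starRingEnd ℂ) (T n) * T n := by
      rw [hΛ2]; push_cast
      refine Finset.sum_congr rfl fun n _ => ?_
      rw [RCLike.conj_mul, ← ofReal_pow]; norm_cast
    rw [h1]
    have h2 : ∀ n ∈ F, (starRingEnd ℂ) (T n) * T n =
        ∑ l ∈ S, ∫ x : UnitAddTorus (Fin 2), ((starRingEnd ℂ) (T n) * χ l * e l * mFourier (-![n, l]) x) * b x := by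
      intro n _
      rw [show T n = ∑ l ∈ S, χ l * mFourierCoeff b ![n, l] * e l from rfl, Finset.mul_sum]
      exact Finset.sum_congr rfl fun l _ => hterm n l
    rw [Finset.sum_congr rfl h2]
    have h3 : ∑ n ∈ F, ∑ l ∈ S, ∫ x : UnitAddTorus (Fin 2), ((starRingEnd ℂ) (T n) * χ l * e l * mFourier (-![n, l]) x) * b x =
        ∫ x : UnitAddTorus (Fin 2), ∑ n ∈ F, ∑ l ∈ S, ((starRingEnd ℂ) (T n) * χ l * e l * mFourier (-![n, l]) x) * b x := by
      rw [integral_finsetSum _ fun n _ => integrable_finsetSum _ fun l _ => hint n l]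
      refine Finset.sum_congr rfl fun n _ => ?_
      rw [integral_finsetSum _ fun l _ => hint n l]
    rw [h3]
    refine integral_congr_ae (ae_of_all _ fun x => ?_)
    dsimp only
    have h4 : Ψ x * b x = (∑ n ∈ F, (starRingEnd ℂ) (T n) * fourier (-n) (x 0)) *
        (∑ l ∈ S, χ l * e l * fourier (-l) (x 1)) * b x := rfl
    rw [h4, Finset.sum_mul_sum, Finset.sum_mul]
    refine Finset.sum_congr rfl fun n _ => ?_
    rw [Finset.sum_mul]
    refine Finset.sum_congr rfl fun l _ => ?_
    rw [mFourier_neg_vecCons]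
    ring
  -- (2) `Λ2 ≤ B ∫|Ψ| = B (∫|D|)(∫|K|)`
  have hΨb : Integrable (fun x => Ψ x * b x) volume := by
    have hC : ∀ x, ‖Ψ x‖ ≤ ‖(⟨Ψ, hΨc⟩ : C(UnitAddTorus (Fin 2), ℂ))‖ := fun x =>
      (⟨Ψ, hΨc⟩ : C(UnitAddTorus (Fin 2), ℂ)).norm_coe_le_norm x
    exact hb.bdd_mul hΨc.aestronglyMeasurable (ae_of_all _ hC)
  have hstep : Λ2 ≤ B * ((∫ t : UnitAddCircle, ‖D t‖) * ∫ t : UnitAddCircle, ‖K t‖) := by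
    have h1 : Λ2 = ‖((Λ2 : ℝ) : ℂ)‖ := by rw [norm_real, Real.norm_of_nonneg hΛ2nn]
    rw [h1, hpair]
    refine (norm_integral_le_integral_norm _).trans ?_
    have h2 : ∫ x, ‖Ψ x * b x‖ ≤ ∫ x, B * ‖Ψ x‖ := by
      refine integral_mono hΨb.norm (hΨc.norm.integrable_unitAddTorus.const_mul B) fun x => ?_
      dsimp only
      rw [norm_mul, mul_comm]
      exact mul_le_mul_of_nonneg_right (hB x) (norm_nonneg _)
    refine h2.trans ?_
    rw [integral_const_mul]
    refine mul_le_mul_of_nonneg_left (le_of_eq ?_) hB0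
    have h3 : ∀ x : UnitAddTorus (Fin 2), ‖Ψ x‖ = ‖D (x 0)‖ * ‖K (x 1)‖ := fun x => by rw [hΨ, norm_mul]
    simp_rw [h3]
    exact integral_mul_coord_eq (fun t => ‖D t‖) (fun t => ‖K t‖)
  -- (3) `(∫|D|)² ≤ Λ2` and `∫|K| ≤ K₁`
  have hDL : (∫ t : UnitAddCircle, ‖D t‖) ^ 2 ≤ Λ2 := by
    have h := sq_integral_norm_trigSum_le F (fun n => (starRingEnd ℂ) (T n))
    have e2 : ∑ n ∈ F, ‖(starRingEnd ℂ) (T n)‖ ^ 2 = Λ2 := Finset.sum_congr rfl fun n _ => by rw [RCLike.norm_conj]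
    rwa [e2] at h
  have hD0 : 0 ≤ ∫ t : UnitAddCircle, ‖D t‖ := integral_nonneg fun t => norm_nonneg _
  have hK0 : 0 ≤ ∫ t : UnitAddCircle, ‖K t‖ := integral_nonneg fun t => norm_nonneg _
  have hK1 : ∫ t : UnitAddCircle, ‖K t‖ ≤ K₁ := hK
  have hK₁0 : 0 ≤ K₁ := hK0.trans hK1
  -- (4) conclude: `Λ2 ≤ B K₁ √Λ2`
  have hsq : Real.sqrt Λ2 ^ 2 = Λ2 := Real.sq_sqrt hΛ2nn
  have hDle : ∫ t : UnitAddCircle, ‖D t‖ ≤ Real.sqrt Λ2 := Real.le_sqrt_of_sq_le hDL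
  have h5 : Λ2 ≤ (K₁ * B) * Real.sqrt Λ2 := by
    calc Λ2 ≤ B * ((∫ t : UnitAddCircle, ‖D t‖) * ∫ t : UnitAddCircle, ‖K t‖) := hstep
      _ ≤ B * (Real.sqrt Λ2 * K₁) :=
          mul_le_mul_of_nonneg_left (mul_le_mul hDle hK1 hK0 (Real.sqrt_nonneg _)) hB0
      _ = (K₁ * B) * Real.sqrt Λ2 := by ring
  have h6 : Real.sqrt Λ2 ≤ K₁ * B := by
    by_cases h0 : Real.sqrt Λ2 = 0
    · rw [h0]; positivity
    · have hpos : 0 < Real.sqrt Λ2 := lt_of_le_of_ne (Real.sqrt_nonneg _) (Ne.symm h0)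
      have h7 : Real.sqrt Λ2 * Real.sqrt Λ2 ≤ (K₁ * B) * Real.sqrt Λ2 := by
        rw [Real.mul_self_sqrt hΛ2nn]; exact h5
      exact le_of_mul_le_mul_right h7 hpos
  calc ∑ n ∈ F, ‖T n‖ ^ 2 = Λ2 := rfl
    _ = Real.sqrt Λ2 ^ 2 := hsq.symm
    _ ≤ (K₁ * B) ^ 2 := pow_le_pow_left₀ (Real.sqrt_nonneg _) h6 2

/-! ## §3 The same, V orientation (fibre coordinate `1`, sources along `0`) -/

set_option maxHeartbeats 400000 in
/-- **INPUT-FREE TRACE BOUND, V half-step orientation** (fibre coordinate `1`, sources along `0`).  `b` integrable with `‖b x‖ ≤ B` everywhere, `χ` a multiplier on the finite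
source set `S`, `F` a finite set of fibres, `y ∈ ℝ`, and `∫_𝕋 |Σ_{l∈S} χ_l e^{2πily} e_{−l}(t)| dt ≤ K₁`.  Then
`Σ_{n∈F} |Σ_{l∈S} χ_l 𝓕b(l,n) e^{2πily}|² ≤ (K₁B)²`. [cite: Grafakos2014, Prop. 3.1.2 (5), Prop. 3.2.7 (3)] -/
theorem sum_sq_trace_le_vfibre (hb : Integrable b volume) {B : ℝ} (hB : ∀ x, ‖b x‖ ≤ B) (χ : ℤ → ℂ) (S F : Finset ℤ)
    (y : ℝ) {K₁ : ℝ} (hK : ∫ t : UnitAddCircle, ‖∑ l ∈ S, χ l * cexp (2 * π * I * l * y) * fourier (-l) t‖ ≤ K₁) :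
    ∑ n ∈ F, ‖∑ l ∈ S, χ l * mFourierCoeff b ![l, n] * cexp (2 * π * I * l * y)‖ ^ 2 ≤ (K₁ * B) ^ 2 := by
  classical
  have hB0 : 0 ≤ B := le_trans (norm_nonneg _) (hB 0)
  set e : ℤ → ℂ := fun l => cexp (2 * π * I * l * y) with he
  set T : ℤ → ℂ := fun n => ∑ l ∈ S, χ l * mFourierCoeff b ![l, n] * e l with hT
  set Λ2 : ℝ := ∑ n ∈ F, ‖T n‖ ^ 2 with hΛ2
  have hΛ2nn : 0 ≤ Λ2 := Finset.sum_nonneg fun n _ => sq_nonneg _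
  -- the two one-variable factors
  set D : UnitAddCircle → ℂ := fun t => ∑ n ∈ F, (starRingEnd ℂ) (T n) * fourier (-n) t with hD
  set K : UnitAddCircle → ℂ := fun t => ∑ l ∈ S, χ l * e l * fourier (-l) t with hKdef
  have hDc : Continuous D := by
    refine continuous_finsetSum _ fun n _ => continuous_const.mul (fourier (-n)).continuous
  have hKc : Continuous K := by
    refine continuous_finsetSum _ fun l _ => continuous_const.mul (fourier (-l)).continuous
  set Ψ : UnitAddTorus (Fin 2) → ℂ := fun x => K (x 0) * D (x 1) with hΨ
  have hΨc : Continuous Ψ := (hKc.comp (continuous_apply 0)).mul (hDc.comp (continuous_apply 1))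
  -- (1) the pairing identity `Σ_n conj(T n) T n = ∫ Ψ b`
  have hterm : ∀ n l, (starRingEnd ℂ) (T n) * (χ l * mFourierCoeff b ![l, n] * e l) =
      ∫ x : UnitAddTorus (Fin 2), ((starRingEnd ℂ) (T n) * χ l * e l * mFourier (-![l, n]) x) * b x := by
    intro n l
    have h1 : mFourierCoeff b ![l, n] = ∫ x : UnitAddTorus (Fin 2), mFourier (-![l, n]) x * b x := by
      rw [Torus.mFourierCoeff_eq_integral_volume]; rfl
    calc (starRingEnd ℂ) (T n) * (χ l * mFourierCoeff b ![l, n] * e l)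
        = ((starRingEnd ℂ) (T n) * χ l * e l) * ∫ x : UnitAddTorus (Fin 2), mFourier (-![l, n]) x * b x := by
          rw [h1]; ring
      _ = ∫ x : UnitAddTorus (Fin 2), ((starRingEnd ℂ) (T n) * χ l * e l) * (mFourier (-![l, n]) x * b x) :=
          (integral_const_mul _ _).symm
      _ = ∫ x : UnitAddTorus (Fin 2), ((starRingEnd ℂ) (T n) * χ l * e l * mFourier (-![l, n]) x) * b x :=
          integral_congr_ae (ae_of_all _ fun x => by ring)
  have hint : ∀ n l, Integrable (fun x : UnitAddTorus (Fin 2) =>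
      ((starRingEnd ℂ) (T n) * χ l * e l * mFourier (-![l, n]) x) * b x) volume := by
    intro n l
    refine hb.bdd_mul (c := ‖(starRingEnd ℂ) (T n) * χ l * e l‖)
      ((continuous_const.mul (mFourier (-![l, n])).continuous).aestronglyMeasurable) (ae_of_all _ fun x => ?_)
    rw [norm_mul]
    have h1 : ‖mFourier (-![l, n]) x‖ ≤ 1 := by
      have := (mFourier (-![l, n])).norm_coe_le_norm x
      rwa [mFourier_norm] at this
    exact mul_le_of_le_one_right (norm_nonneg _) h1
  have hpair : ((Λ2 : ℝ) : ℂ) = ∫ x, Ψ x * b x := by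
    have h1 : ((Λ2 : ℝ) : ℂ) = ∑ n ∈ F, (starRingEnd ℂ) (T n) * T n := by
      rw [hΛ2]; push_cast
      refine Finset.sum_congr rfl fun n _ => ?_
      rw [RCLike.conj_mul, ← ofReal_pow]; norm_cast
    rw [h1]
    have h2 : ∀ n ∈ F, (starRingEnd ℂ) (T n) * T n =
        ∑ l ∈ S, ∫ x : UnitAddTorus (Fin 2), ((starRingEnd ℂ) (T n) * χ l * e l * mFourier (-![l, n]) x) * b x := by
      intro n _
      rw [show T n = ∑ l ∈ S, χ l * mFourierCoeff b ![l, n] * e l from rfl, Finset.mul_sum]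
      exact Finset.sum_congr rfl fun l _ => hterm n l
    rw [Finset.sum_congr rfl h2]
    have h3 : ∑ n ∈ F, ∑ l ∈ S, ∫ x : UnitAddTorus (Fin 2), ((starRingEnd ℂ) (T n) * χ l * e l * mFourier (-![l, n]) x) * b x =
        ∫ x : UnitAddTorus (Fin 2), ∑ n ∈ F, ∑ l ∈ S, ((starRingEnd ℂ) (T n) * χ l * e l * mFourier (-![l, n]) x) * b x := by
      rw [integral_finsetSum _ fun n _ => integrable_finsetSum _ fun l _ => hint n l]
      refine Finset.sum_congr rfl fun n _ => ?_
      rw [integral_finsetSum _ fun l _ => hint n l]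
    rw [h3]
    refine integral_congr_ae (ae_of_all _ fun x => ?_)
    dsimp only
    have h4 : Ψ x * b x = (∑ l ∈ S, χ l * e l * fourier (-l) (x 0)) *
        (∑ n ∈ F, (starRingEnd ℂ) (T n) * fourier (-n) (x 1)) * b x := rfl
    rw [h4, Finset.sum_mul_sum, Finset.sum_mul, Finset.sum_comm]
    refine Finset.sum_congr rfl fun n _ => ?_
    rw [Finset.sum_mul]
    refine Finset.sum_congr rfl fun l _ => ?_
    rw [mFourier_neg_vecCons]
    ring
  -- (2) `Λ2 ≤ B ∫|Ψ| = B (∫|D|)(∫|K|)`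
  have hΨb : Integrable (fun x => Ψ x * b x) volume := by
    have hC : ∀ x, ‖Ψ x‖ ≤ ‖(⟨Ψ, hΨc⟩ : C(UnitAddTorus (Fin 2), ℂ))‖ := fun x =>
      (⟨Ψ, hΨc⟩ : C(UnitAddTorus (Fin 2), ℂ)).norm_coe_le_norm x
    exact hb.bdd_mul hΨc.aestronglyMeasurable (ae_of_all _ hC)
  have hstep : Λ2 ≤ B * ((∫ t : UnitAddCircle, ‖D t‖) * ∫ t : UnitAddCircle, ‖K t‖) := by
    have h1 : Λ2 = ‖((Λ2 : ℝ) : ℂ)‖ := by rw [norm_real, Real.norm_of_nonneg hΛ2nn]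
    rw [h1, hpair]
    refine (norm_integral_le_integral_norm _).trans ?_
    have h2 : ∫ x, ‖Ψ x * b x‖ ≤ ∫ x, B * ‖Ψ x‖ := by
      refine integral_mono hΨb.norm (hΨc.norm.integrable_unitAddTorus.const_mul B) fun x => ?_
      dsimp only
      rw [norm_mul, mul_comm]
      exact mul_le_mul_of_nonneg_right (hB x) (norm_nonneg _)
    refine h2.trans ?_
    rw [integral_const_mul]
    refine mul_le_mul_of_nonneg_left (le_of_eq ?_) hB0
    have h3 : ∀ x : UnitAddTorus (Fin 2), ‖Ψ x‖ = ‖K (x 0)‖ * ‖D (x 1)‖ := fun x => by rw [hΨ, norm_mul]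
    simp_rw [h3]
    rw [integral_mul_coord_eq (fun t => ‖K t‖) (fun t => ‖D t‖), mul_comm]
  -- (3) `(∫|D|)² ≤ Λ2` and `∫|K| ≤ K₁`
  have hDL : (∫ t : UnitAddCircle, ‖D t‖) ^ 2 ≤ Λ2 := by
    have h := sq_integral_norm_trigSum_le F (fun n => (starRingEnd ℂ) (T n))
    have e2 : ∑ n ∈ F, ‖(starRingEnd ℂ) (T n)‖ ^ 2 = Λ2 := Finset.sum_congr rfl fun n _ => by rw [RCLike.norm_conj]
    rwa [e2] at h
  have hD0 : 0 ≤ ∫ t : UnitAddCircle, ‖D t‖ := integral_nonneg fun t => norm_nonneg _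
  have hK0 : 0 ≤ ∫ t : UnitAddCircle, ‖K t‖ := integral_nonneg fun t => norm_nonneg _
  have hK1 : ∫ t : UnitAddCircle, ‖K t‖ ≤ K₁ := hK
  have hK₁0 : 0 ≤ K₁ := hK0.trans hK1
  -- (4) conclude: `Λ2 ≤ B K₁ √Λ2`
  have hsq : Real.sqrt Λ2 ^ 2 = Λ2 := Real.sq_sqrt hΛ2nn
  have hDle : ∫ t : UnitAddCircle, ‖D t‖ ≤ Real.sqrt Λ2 := Real.le_sqrt_of_sq_le hDL
  have h5 : Λ2 ≤ (K₁ * B) * Real.sqrt Λ2 := by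
    calc Λ2 ≤ B * ((∫ t : UnitAddCircle, ‖D t‖) * ∫ t : UnitAddCircle, ‖K t‖) := hstep
      _ ≤ B * (Real.sqrt Λ2 * K₁) :=
          mul_le_mul_of_nonneg_left (mul_le_mul hDle hK1 hK0 (Real.sqrt_nonneg _)) hB0
      _ = (K₁ * B) * Real.sqrt Λ2 := by ring
  have h6 : Real.sqrt Λ2 ≤ K₁ * B := by
    by_cases h0 : Real.sqrt Λ2 = 0
    · rw [h0]; positivity
    · have hpos : 0 < Real.sqrt Λ2 := lt_of_le_of_ne (Real.sqrt_nonneg _) (Ne.symm h0)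
      have h7 : Real.sqrt Λ2 * Real.sqrt Λ2 ≤ (K₁ * B) * Real.sqrt Λ2 := by
        rw [Real.mul_self_sqrt hΛ2nn]; exact h5
      exact le_of_mul_le_mul_right h7 hpos
  calc ∑ n ∈ F, ‖T n‖ ^ 2 = Λ2 := rfl
    _ = Real.sqrt Λ2 ^ 2 := hsq.symm
    _ ≤ (K₁ * B) ^ 2 := pow_le_pow_left₀ (Real.sqrt_nonneg _) h6 2

end Core

end Summit.AnomalousDissipation.AnomalousDissipation.Theorems.SawtoothPulseCascade.K1Window
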